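import Summits.QuantumFields.GaugeBoot.DiagonalRPTorusHexObservable
import Summits.QuantumFields.GaugeBoot.DiagonalRPTorusUnitaryCharacter
import HarnessLib

/-!
# Inner-half diagonal RP fails on `(ℤ/L)^3` with a coupling window UNIFORM in `L` (gauge-boot, L3 `d = 3` uniform window, assembly)

HONEST FRAMING (cell `pub-gaugeboot`, page 1 of every file): the venture produces certified bounds
on lattice expectations at stated coupling, gauge group, dimension and torus size; NOT a mass gap,
NOT a continuum limit, NOT a string tension; NOT Yang–Mills-summit-bearing (barriers
`FixedCouplingUltralocality`, `PerturbativeInvisibility`). This module is a structural NEGATIVE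
result about a reflection-positivity HYPOTHESIS on discrete tori (the third RP family of KZ2022 —
reflections in the diagonal hyperplanes `x_i = ± x_j` — transplanted to `(ℤ/L)^3`): it completes
the `d = 3` leg of the tribunal's question A3 (`HOME/tribunal/t1.md`), the `d ≥ 4` legs being
`DiagonalRPTorusNegativeHighDimUniform` (lean3 gen 45). It certifies no bound of the venture.

## Content (torus `(ℤ/L)^3`, mirror `y₀ = y₁`, `L` even, compact metrisable `G`, continuous `ρ`)

* ★★★ **`not_innerDiagonalRP_even_three_uniform_of_moments`** — under the centre-element
  hypothesis `ρ z₀ = ω • 1`, `ω ≠ 1` and the character identity (R1) with constant `c₁ > 0`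
  (`N ≥ 1`), there is ONE `β₀ = β₀(ρ) > 0` such that for EVERY even `L ≥ 36` and every
  `0 < β ≤ β₀`, `¬ InnerDiagonalRP ρ β 0 1` on `(ℤ/L)^3`.
  WITNESS: the bent hexagon `Re χ(W_{γ_{y₀}}) - Re χ(W_{γ_y})` (`DiagonalRPTorusHexObservable`);
  MECHANISM: the half-action trick (`DiagonalRPTorusHalfAction`) + the EXACT reduction of the trick
  form to truncated rest correlations (lean3 gen 46: dictionary to the Literature plaquette system,
  uniform clustering of the far pairs, Schwarz lemma with multiplicity for the near pair,
  `DiagRPUnif.trickForm_sub_translate_neg_of_jet`) + the ORDER-10 JET of the near pair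
  `τ₁₀ = c₁^{11} N > 0` (lean3 gen 47: (J1) the kernel-checked forest-split classification
  `DiagonalRPTorusHexShape`, (J2) the kernel-checked strong-coupling diagrams
  `DiagonalRPTorusHexAnnulusValue`).
* ★★ `…_specialUnitary` (`G ≅ SU(N)`, `N ≥ 2`), ★★ `…_unitary` (`G ≅ U(N)`, `N ≥ 1`): the moment
  hypotheses discharged (`DiagonalRPTorusCharacterMoments`, `DiagonalRPTorusUnitaryCharacter`).

Smaller even `L` (`4 ≤ L < 36`) have their own (L-dependent) windows by
`DiagonalRPTorusInnerHalfNegativeThreeAll` (lean3 gen 44); combining the finitely many is routine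
and not done here. No named fact; standard axioms (two `decide +kernel` certificates upstream).
-/

open MeasureTheory Finset Function Filter Asymptotics
open scoped Topology

namespace Summit.QuantumFields.GaugeBoot

open Literature.MathematicalPhysics.QuantumFieldTheory
open Literature.MathematicalPhysics.QuantumFieldTheory.PlaquetteLowerBound (reTr)

noncomputable section

namespace DiagRPHex

open DiagRPTube DiagRPUnif

variable {N : ℕ} {G : Type*} [Group G] [TopologicalSpace G] [IsTopologicalGroup G] [CompactSpace G]
  [MeasurableSpace G] [BorelSpace G] [SecondCountableTopology G] (ρ : G →* Matrix (Fin N) (Fin N) ℂ)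

/-! ## Small facts about the base points -/

section Base

variable {L : ℕ}

/-- The hexagon has six links (`L > 8`). -/
theorem card_hexLinks (hL : 8 < L) (y₀ : Site 3 L) : (hexLinks y₀).card = 6 := by
  rw [← Et_LE₂, Et, List.card_toFinset, List.Nodup.dedup, List.length_map]
  · rfl
  · have hnd : LE₂.Nodup := by decide
    exact hnd.map_on fun a ha b hb h => edge_injOn y₀ (B := 4) (by omega) (inBox_LE₂ a ha) (inBox_LE₂ b hb) h

omit [TopologicalSpace G] [IsTopologicalGroup G] [CompactSpace G] [MeasurableSpace G] [BorelSpace G]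
  [SecondCountableTopology G] in
/-- `hexG` is the hexagon observable at the base. -/
theorem hexG_eq_hexObs (y : Site 3 L) : hexG (G := G) ρ y = hexObs ρ y := by
  funext U; simp [hexG, hexObs, site_zero]

variable {c : ℕ}

/-- The layer of the mirrored base: `δ(θ(y + 2e₀)) = c - 1` when `δ(y) = c - 1`, `L = 2c`. -/
theorem lay_y₀ (hc : 1 ≤ c) (hL : L = 2 * c) {y : Site 3 L} (hy : lay (0 : Fin 3) 1 y = ((c - 1 : ℕ) : ZMod L)) :
    lay (0 : Fin 3) 1 (siteDiagSwap (0 : Fin 3) 1 (site y (2, 0, 0))) = ((c - 1 : ℕ) : ZMod L) := by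
  rw [lay_siteDiagSwap, lay_site, hy]
  have h2c : ((2 * c : ℕ) : ZMod L) = 0 := by rw [← hL]; exact ZMod.natCast_self L
  simp only [loff]
  push_cast [Nat.cast_sub hc] at h2c ⊢
  linear_combination -h2c

/-- `cyc (c - 1) = c - 1` in `ℤ/(2c)`. -/
theorem cyc_cast_pred (hc : 1 ≤ c) (hL : L = 2 * c) : cyc (((c - 1 : ℕ) : ZMod L)) = c - 1 := by
  unfold cyc
  rw [ZMod.valMinAbs_natCast_of_le_half (by omega)]
  simp

end Base

/-! ## The uniform window -/

/-- ★★★ **INNER-HALF DIAGONAL RP FAILS ON `(ℤ/L)^3` WITH AN `L`-INDEPENDENT WINDOW** (moment form):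
under the centre twist and (R1) with `c₁ > 0` (`N ≥ 1`), one `β₀ > 0` serves every even `L ≥ 36`. -/
theorem not_innerDiagonalRP_even_three_uniform_of_moments (hρ : Continuous ρ) (hN : 1 ≤ N)
    {z₀ : G} {ω : ℂ} (hz₀ : ρ z₀ = ω • (1 : Matrix (Fin N) (Fin N) ℂ)) (hω : ω ≠ 1) {c₁ : ℝ}
    (hc₁ : 0 < c₁)
    (hR1 : ∀ x y : G, ∫ g, reTr ρ (x * g⁻¹) * reTr ρ (g * y) ∂haarProbability G = c₁ * reTr ρ (x * y)) :
    ∃ β₀ : ℝ, 0 < β₀ ∧ ∀ (L : ℕ) [NeZero L], Even L → 36 ≤ L → ∀ β : ℝ, 0 < β → β ≤ β₀ →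
      ¬ InnerDiagonalRP (d := 3) (L := L) ρ β 0 1 := by
  -- the L-free constants
  set β₁ : ℝ := betaOne 3 ρ with hβ₁
  have hβ₁0 : 0 < β₁ := betaOne_pos 3 (ρ := ρ)
  set r : ℝ := β₁ / 2 with hr
  have hr0 : 0 < r := by positivity
  have hrR : r < β₁ := by rw [hr]; linarith
  set τ : ℝ := c₁ ^ 11 * N with hτ
  have hN0 : (0 : ℝ) < N := by exact_mod_cast hN
  have hτ0 : 0 < τ := by positivity
  -- the clustering constant, kept opaque (its exponent is large)
  obtain ⟨K, hK0, hKdef⟩ : ∃ K : ℝ, 0 ≤ K ∧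
      K = 2 * (N : ℝ) * N * (2 * Real.exp (1 / 2)) ^ ((6 + 6) * (2 ^ 3 * (3 * 3))) :=
    ⟨_, mul_nonneg (by positivity) (pow_nonneg (by positivity) _), rfl⟩
  set X : ℝ := τ * r ^ (10 + 1) / (2 * K + (K + |τ| * β₁ ^ 10) + 1) with hX
  have hX0 : 0 < X := by
    rw [hX]
    refine div_pos (mul_pos hτ0 (pow_pos hr0 _)) ?_
    have := mul_nonneg (abs_nonneg τ) (pow_nonneg hβ₁0.le 10)
    linarith
  refine ⟨min r (X / 2), lt_min hr0 (half_pos hX0), ?_⟩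
  intro L _ hLeven h36 β hβ hβ0
  obtain ⟨c, hcc⟩ := hLeven
  have hL : L = 2 * c := by omega
  have hc18 : 18 ≤ c := by omega
  have hL2 : L / 2 = c := by omega
  have hβr : β ≤ r := hβ0.trans (min_le_left _ _)
  have hβX : β < X := lt_of_le_of_lt (hβ0.trans (min_le_right _ _)) (by linarith)
  -- base points
  set y : Site 3 L := fun k => if k = 0 then (((c - 1 : ℕ) : ZMod L)) else 0 with hydef
  have hy : lay (0 : Fin 3) 1 y = ((c - 1 : ℕ) : ZMod L) := by simp [lay, hydef]
  set y₀ : Site 3 L := siteDiagSwap (0 : Fin 3) 1 (site y (2, 0, 0)) with hy₀def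
  have hy₀ : lay (0 : Fin 3) 1 y₀ = ((c - 1 : ℕ) : ZMod L) := lay_y₀ (by omega) hL hy
  set a : Site 3 L := y - y₀ with hadef
  have ha : lay (0 : Fin 3) 1 a = 0 := by
    have : lay (0 : Fin 3) 1 a = lay 0 1 y - lay 0 1 y₀ := by simp [lay, hadef]; ring
    rw [this, hy, hy₀, sub_self]
  -- the witness and its properties
  set O : GaugeConfig 3 L G → ℝ := hexObs ρ y₀ with hO
  have hOm : Measurable O := (continuous_reTr_wordHolonomy ρ hρ _ _).measurable
  have hOb : ∀ U, |O U| ≤ (N : ℝ) := fun U => abs_reTr_wordHolonomy_le ρ hρ _ _ U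
  have hOE : DependsOn O (hexLinks y₀ : Set (Edge 3 L)) := dependsOn_hexObs ρ y₀
  have hE : ∀ e ∈ hexLinks y₀, tsd y₀ e.1 ≤ 1 := tsd_hexLinks_le y₀
  have hF : (fun U => O (configDiagSwap (0 : Fin 3) 1 U)) = hexF ρ y := by
    funext U; exact hexObs_configDiagSwap ρ y U
  have hG : (fun U : GaugeConfig 3 L G => O (U.siteTranslate a)) = hexG ρ y := by
    funext U; exact hexObs_siteTranslate ρ y y₀ U
  -- the jet of the near pair (J1 + J2)
  have hL8 : 8 < L := by omega
  have hfm : Measurable (hexF (G := G) ρ y) := (continuous_reTr_wordHolonomy ρ hρ _ _).measurable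
  have hgm : Measurable (hexG (G := G) ρ y) := (continuous_reTr_wordHolonomy ρ hρ _ _).measurable
  have hfb : ∀ U, |hexF (G := G) ρ y U| ≤ (N : ℝ) := fun U => abs_reTr_wordHolonomy_le ρ hρ _ _ U
  have hgb : ∀ U, |hexG (G := G) ρ y U| ≤ (N : ℝ) := fun U => abs_reTr_wordHolonomy_le ρ hρ _ _ U
  have hsmall := sum_replicaTerm_small_eq_hexTube ρ (by omega) hL hy hρ hfm hgm hfb hgb
    (isGaugeInvariant_hexF ρ y) (dependsOn_hexF ρ y) (dependsOn_hexG ρ y)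
  have hjet : (fun z => restTruncC ρ (restPlaqs (0 : Fin 3) 1 c)
      (fun U => O (configDiagSwap (0 : Fin 3) 1 U)) (fun U : GaugeConfig 3 L G => O (U.siteTranslate a)) z -
        (τ : ℂ) * z ^ 10) =O[𝓝 (0 : ℂ)] fun z => z ^ (10 + 1) := by
    rw [hF, hG]
    refine restTruncC_jet_of_smallClusters ρ hρ (restPlaqs (0 : Fin 3) 1 c) hfm hgm hfb hgb
      (dependsOn_hexF ρ y) (dependsOn_hexG ρ y) (disjoint_Et hL8 y) ?_
    have hj := replicaTerm_hexTube_jet ρ y hL8 hρ hz₀ hω hR1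
    have h2 := hj.const_mul_left (1 / 2 : ℂ)
    refine h2.congr' (Eventually.of_forall fun z => ?_) EventuallyEq.rfl
    simp only [hsmall z, hτ]
    push_cast
    ring
  have hfar : 2 * 1 + 10 + 3 ≤ cyc (lay (0 : Fin 3) 1 y₀) := by
    rw [hy₀, cyc_cast_pred (by omega) hL]; omega
  have hcard : (hexLinks y₀).card = 6 := card_hexLinks hL8 y₀
  have hβc : β < τ * r ^ (10 + 1) /
      (2 * (2 * (N : ℝ) * N * (2 * Real.exp (1 / 2)) ^ (((hexLinks y₀).card + (hexLinks y₀).card) *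
        (2 ^ 3 * (3 * 3)))) +
        (2 * (N : ℝ) * N * (2 * Real.exp (1 / 2)) ^ (((hexLinks y₀).card + (hexLinks y₀).card) *
          (2 ^ 3 * (3 * 3))) + |τ| * betaOne 3 ρ ^ 10) + 1) := by
    rw [hcard, ← hKdef]; exact hβX
  have hneg := trickForm_sub_translate_neg_of_jet β (0 : Fin 3) 1 c hρ hOm hOb hOE hE ha hjet hfar hr0
    hrR hβ hβr hβc
  -- the refutation schema
  have hA : Continuous fun U : GaugeConfig 3 L G => O U - O (U.siteTranslate a) :=
    (continuous_reTr_wordHolonomy ρ hρ _ _).sub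
      ((continuous_reTr_wordHolonomy ρ hρ _ _).comp (continuous_pi fun _ => continuous_apply _))
  have hAI : IsInnerHalfObservable (0 : Fin 3) 1 fun U : GaugeConfig 3 L G => O U - O (U.siteTranslate a) := by
    have : (fun U : GaugeConfig 3 L G => O U - O (U.siteTranslate a)) =
        fun U => hexObs ρ y₀ U - hexObs ρ y U := by
      funext U; rw [hO, hexObs_siteTranslate ρ y y₀ U, hexG_eq_hexObs]
    rw [this]
    exact isInnerHalfObservable_hexObs_sub ρ (by omega) hL hy₀ hy
  rw [← hL2] at hneg
  exact not_innerDiagonalRP_of_trickForm_neg ρ hρ hA hAI hneg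

/-- ★★ **Uniform window for `G ≅ SU(N)`** (`N ≥ 2`) on `(ℤ/L)^3`: one `β₀(N) > 0` for all even
`L ≥ 36`. -/
theorem not_innerDiagonalRP_even_three_uniform_specialUnitary (hρ : IsSpecialUnitaryModel ρ)
    (hN : 2 ≤ N) :
    ∃ β₀ : ℝ, 0 < β₀ ∧ ∀ (L : ℕ) [NeZero L], Even L → 36 ≤ L → ∀ β : ℝ, 0 < β → β ≤ β₀ →
      ¬ InnerDiagonalRP (d := 3) (L := L) ρ β 0 1 := by
  obtain ⟨z₀, ω, hω, hz₀⟩ := DiagRPSUN.exists_smul_one ρ hρ hN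
  obtain ⟨c₁, hc₁, hR1⟩ := DiagRPSUN.exists_re_conv_const ρ hρ hN
  exact not_innerDiagonalRP_even_three_uniform_of_moments ρ hρ.1 (by omega) hz₀ hω hc₁ hR1

/-- ★★ **Uniform window for `G ≅ U(N)`** (`N ≥ 1`) on `(ℤ/L)^3`: one `β₀(N) > 0` for all even
`L ≥ 36`. -/
theorem not_innerDiagonalRP_even_three_uniform_unitary (hρ : IsUnitaryModel ρ) (hN : 1 ≤ N) :
    ∃ β₀ : ℝ, 0 < β₀ ∧ ∀ (L : ℕ) [NeZero L], Even L → 36 ≤ L → ∀ β : ℝ, 0 < β → β ≤ β₀ →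
      ¬ InnerDiagonalRP (d := 3) (L := L) ρ β 0 1 := by
  obtain ⟨z₀, ω, hω, hz₀⟩ := DiagRPSUN.exists_smul_one_unitary ρ hρ
  have hNpos : (0 : ℝ) < N := by exact_mod_cast hN
  exact not_innerDiagonalRP_even_three_uniform_of_moments ρ hρ.1 hN hz₀ hω
    (c₁ := (2 * N : ℝ)⁻¹) (by positivity) (DiagRPSUN.integral_re_trace_mul_inv_mul_unitary ρ hρ)

end DiagRPHex

end

end Summit.QuantumFields.GaugeBoot
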